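import Summits.HodgeConjecture.HodgeConjecture.Theorems.NikulinTwinTransportRealMultiplicationPointwise
import Summits.HodgeConjecture.HodgeConjecture.Theorems.NikulinTwinTransportRealMultiplicationAnchorOfAlgebraic
import Literature.AlgebraicGeometry.HodgeTheory.AlgebraicClassesCup

/-!
# Route NikulinTwinTransport · `RealMultiplicationSqrtTwoAlgebraic` (stmt-HodgeConjecture-13679) —
# what the milestone crux `TwinTransportRMPicardTwo` buys, and the moving-lemma forms

Companion of `NikulinTwinTransportRealMultiplicationPointwise` (the pointwise chain
anchor ⟹ X at `(S, ·)` ⟹ real multiplication algebraic at `S`):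

* `realMultiplication_algebraic_of_twinTransportRMPicardTwo` — the route's crux
  `TwinTransportRMPicardTwo` (stmt-HodgeConjecture-15067, the judge's milestone: RM-anchors for the
  Picard-rank-`2` members of the maximal RM-`√2` families) BY NAME, together with Buskin's theorem
  (`HodgeIsometryAlgebraic`), the composition of algebraic correspondences between surfaces and the
  three named facts, yields the deliverable ON THAT CLASS: for every projective K3 surface of Picard
  rank `2`, real multiplication by `√2` is algebraic (the body of `RealMultiplicationSqrtTwoAlgebraic`
  with the extra hypothesis `finrank NS = 2`). This is the kernel form of the route text's "at
  End-generic `S`, given Buskin + L(1,1), #3 ⟹ `√2` algebraic on `T(S)`".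
* `realMultiplicationSqrtTwoAlgebraic_of_rmAnchors_of_cup`,
  `realMultiplication_algebraic_of_twinTransportRMPicardTwo_of_cup` — the same with the
  composition of correspondences supplied by the tree's `corrComp_surfaces_of_cup'` from the
  multiplicativity `N²H⁴ ∪ N²H⁴ ⊆ N⁴H⁸` on triple products of smooth projective surfaces (Voisin II
  Prop. 9.20), and `…_of_moving` from the moving-lemma hypothesis of
  `cupProduct_mem_algebraicClasses_of_moving` (Fulton §11.4) — exactly as for `TwinAnchorGlue`
  (`Theorems.twinAnchorGlue_of_cup`, `Theorems.twinAnchorGlue_of_moving`).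

* `realMultiplicationSqrtTwoAlgebraic_iff_rmAnchors_adj` — THE EQUIVALENCE, modulo Buskin, the
  composition of correspondences and the three named facts: the route decl
  `RealMultiplicationSqrtTwoAlgebraic` holds iff every projective K3 surface carrying a rational,
  type-preserving, cup-self-adjoint `e` killing `NS` with `e² = 2` on `NS^⊥` admits an RM-anchor
  (for every integral generator of `H⁴`) — (⟸) the pointwise chain, (⟹) the sibling converse
  `rmAnchors_of_realMultiplicationSqrtTwoAlgebraic` (`S″ = S`, `Ψ = e + ν̃`).

Not here: the anchors (open: arXiv:2310.05196 Rem. 4.9), Buskin's theorem, the moving lemma.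
Prover seat prover-pitem-stmt-HodgeConjecture-13679-1.

## References

* [VanGeemenSchuett2023] B. van Geemen, M. Schütt, arXiv:2310.05196, Thm. 3.10, Rem. 4.9.
* [Varesco2023] M. Varesco, Math. Z. 305 (2023), §2, Thm. 2.1.
* [Buskin2019] N. Buskin, J. reine angew. Math. 755 (2019), Thm. 1.1, Lemma 6.3.
* [VoisinHodgeII2003] C. Voisin, Hodge Theory and Complex Algebraic Geometry II, Prop. 9.20.
* [Fulton1998] W. Fulton, Intersection Theory, §11.4, §16.1.
-/

noncomputable section

namespace Summit.HodgeConjecture.HodgeConjecture.Theorems.NikulinTwinTransport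

open scoped Manifold
open CategoryTheory MonoidalCategory SemiCartesianMonoidalCategory
open Literature.AlgebraicGeometry.Motives Literature.AlgebraicGeometry.HodgeTheory
open Literature.AlgebraicGeometry.Surfaces Literature.Geometry.Kaehler
open Literature.AlgebraicTopology.SingularHomology

/-- **What the milestone crux buys: real multiplication by `√2` is algebraic on every projective K3
surface of Picard rank `2`, granted `TwinTransportRMPicardTwo` (stmt-HodgeConjecture-15067), Buskin's
theorem, the composition of correspondences and the three named facts.** The crux supplies, for the
given `e`, an algebraic anchor `Ψ : H²(S″) ≃ H²(S)` for every integral generator of `H⁴(S(ℂ))`;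
the pointwise chain `realMultiplication_algebraic_at_of_anchors_at` does the rest (the crux's `e`
is not assumed self-adjoint, ours is, so it applies). [cite: VanGeemenSchuett2023, Thm. 3.10 and Rem. 4.9]
[cite: Varesco2023, §2] [cite: Buskin2019, Thm. 1.1] -/
theorem realMultiplication_algebraic_of_twinTransportRMPicardTwo
    (hB : Theses.NikulinTwinTransport.HodgeIsometryAlgebraic)
    (hC : ∀ (μ : OrientationFamily), μ.HasPoincareDuality →
      ∀ (A B C : SchemeOver ℂ) (hA : IsSmoothProjective 2 A) (hB : IsSmoothProjective 2 B)
        (hC : IsSmoothProjective 2 C),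
        ∀ γ ∈ algebraicClasses (A ⊗ B) 2, ∀ γ₁ ∈ algebraicClasses (B ⊗ C) 2,
          ∃ γ₂ ∈ algebraicClasses (A ⊗ C) 2, ∀ x : complexBetti C (2 * 1),
            complexGysin μ (IsSmoothProjective.tensor_holds hA hC) hA (fst A C)
                (rfl : 2 * 1 + 2 * 2 + 2 * 2 = 2 * 1 + 2 * (2 + 2))
                (cupProduct (rfl : 2 * 1 + 2 * 2 = 2 * 1 + 2 * 2)
                  (complexBetti.map (snd A C) (2 * 1) x) γ₂) =
              complexGysin μ (IsSmoothProjective.tensor_holds hA hB) hA (fst A B)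
                (rfl : 2 * 1 + 2 * 2 + 2 * 2 = 2 * 1 + 2 * (2 + 2))
                (cupProduct (rfl : 2 * 1 + 2 * 2 = 2 * 1 + 2 * 2)
                  (complexBetti.map (snd A B) (2 * 1)
                    (complexGysin μ (IsSmoothProjective.tensor_holds hB hC) hB (fst B C)
                      (rfl : 2 * 1 + 2 * 2 + 2 * 2 = 2 * 1 + 2 * (2 + 2))
                      (cupProduct (rfl : 2 * 1 + 2 * 2 = 2 * 1 + 2 * 2)
                        (complexBetti.map (snd B C) (2 * 1) x) γ₁)))
                  γ))
    (h₃ : Theses.NikulinTwinTransport.TwinTransportRMPicardTwo)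
    (hmark : Huybrechts_K3_marking_exists) (hHT : Huybrechts_K3_hodgeTypes_H2)
    (hG : Grothendieck1969_supportedClasses_le_hodgeConiveau)
    (μ : OrientationFamily) (hμ : μ.HasPoincareDuality) {S : SchemeOver ℂ} (hS : IsK3Surface S)
    (hρ : Module.finrank ℂ ↥(algebraicClasses S 1) = 2)
    (e : complexBetti S (2 * 1) →ₗ[ℂ] complexBetti S (2 * 1))
    (he_rat : ∀ x, IsRationalClass x → IsRationalClass (e x))
    (he_type : ∀ (i j : ℕ) x, IsOfHodgeType 2 S (2 * 1) i j x → IsOfHodgeType 2 S (2 * 1) i j (e x))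
    (he_adj : ∀ x y : complexBetti S (2 * 1),
      cupProduct (rfl : 2 * 1 + 2 * 1 = 2 * 2) (e x) y =
        cupProduct (rfl : 2 * 1 + 2 * 1 = 2 * 2) x (e y))
    (he_N : ∀ d ∈ algebraicClasses S 1, e d = 0)
    (he_T : ∀ x : complexBetti S (2 * 1),
      (∀ d ∈ algebraicClasses S 1, cupProduct (rfl : 2 * 1 + 2 * 1 = 2 * 2) x d = 0) →
        e (e x) = (2 : ℂ) • x) :
    ∃ γ ∈ algebraicClasses (S ⊗ S) 2, ∀ x : complexBetti S (2 * 1),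
      e x = complexGysin μ (IsSmoothProjective.tensor_holds hS.1 hS.1) hS.1 (fst S S)
        (rfl : 2 * 1 + 2 * 2 + 2 * 2 = 2 * 1 + 2 * (2 + 2))
        (cupProduct (rfl : 2 * 1 + 2 * 2 = 2 * 1 + 2 * 2)
          (complexBetti.map (snd S S) (2 * 1) x) γ) :=
  realMultiplication_algebraic_at_of_anchors_at hB hC hmark hHT hG μ hμ hS
    (fun p hp => h₃ μ hμ S hS p hp hρ e he_rat he_type he_N he_T) e he_rat he_type he_adj he_N he_T

/-- **The route decl from RM-anchors, Buskin and the multiplicativity `N² ∪ N² ⊆ N⁴` of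
algebraically supported classes on triple products of smooth projective surfaces** (the
composition of correspondences being then the tree's `corrComp_surfaces_of_cup'`: Künneth
spanning + Gysin base change + `corrCompClass_mem_algebraicClasses`; Voisin II Prop. 9.20).
[cite: VoisinHodgeII2003, §9.2.4 Prop. 9.20] [cite: Buskin2019, Lemma 6.3] -/
theorem realMultiplicationSqrtTwoAlgebraic_of_rmAnchors_of_cup
    (hB : Theses.NikulinTwinTransport.HodgeIsometryAlgebraic)
    (hCUP : ∀ (A B C : SchemeOver ℂ), IsSmoothProjective 2 A → IsSmoothProjective 2 B →
      IsSmoothProjective 2 C →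
      ∀ a ∈ algebraicClasses (A ⊗ (B ⊗ C)) 2, ∀ b ∈ algebraicClasses (A ⊗ (B ⊗ C)) 2,
        cupProduct ((Nat.mul_add 2 2 2).symm : 2 * 2 + 2 * 2 = 2 * (2 + 2)) a b ∈
          algebraicClasses (A ⊗ (B ⊗ C)) (2 + 2))
    (hA : ∀ (μ : OrientationFamily), μ.HasPoincareDuality →
      ∀ (S : SchemeOver ℂ) (hS : IsK3Surface S) (p : complexBetti S (2 * 2)),
      (IsIntegralClass p ∧ ∀ q : complexBetti S (2 * 2), IsIntegralClass q → ∃ n : ℤ, q = n • p) →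
      ∀ (e : complexBetti S (2 * 1) →ₗ[ℂ] complexBetti S (2 * 1)),
        (∀ x, IsRationalClass x → IsRationalClass (e x)) →
        (∀ (i j : ℕ) x, IsOfHodgeType 2 S (2 * 1) i j x → IsOfHodgeType 2 S (2 * 1) i j (e x)) →
        (∀ d ∈ algebraicClasses S 1, e d = 0) →
        (∀ x : complexBetti S (2 * 1),
          (∀ d ∈ algebraicClasses S 1, cupProduct (rfl : 2 * 1 + 2 * 1 = 2 * 2) x d = 0) →
            e (e x) = (2 : ℂ) • x) →
      ∃ (S'' : SchemeOver ℂ) (hS'' : IsK3Surface S'') (p'' : complexBetti S'' (2 * 2)),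
        (IsIntegralClass p'' ∧
          ∀ q : complexBetti S'' (2 * 2), IsIntegralClass q → ∃ n : ℤ, q = n • p'') ∧
        ∃ Ψ : complexBetti S'' (2 * 1) ≃ₗ[ℂ] complexBetti S (2 * 1),
          (∀ y, IsRationalClass y → IsRationalClass (Ψ.symm y)) ∧
          (∀ (i j : ℕ) y, IsOfHodgeType 2 S (2 * 1) i j y →
            IsOfHodgeType 2 S'' (2 * 1) i j (Ψ.symm y)) ∧
          (∀ (u v : complexBetti S (2 * 1)) (b : ℂ),
            cupProduct (rfl : 2 * 1 + 2 * 1 = 2 * 2) u v = ((2 : ℂ) * b) • p →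
              cupProduct (rfl : 2 * 1 + 2 * 1 = 2 * 2) (Ψ.symm u) (Ψ.symm v) = b • p'') ∧
          ∃ γ ∈ algebraicClasses (S ⊗ S'') 2, ∀ x : complexBetti S'' (2 * 1),
            Ψ x = complexGysin μ (IsSmoothProjective.tensor_holds hS.1 hS''.1) hS.1 (fst S S'')
              (rfl : 2 * 1 + 2 * 2 + 2 * 2 = 2 * 1 + 2 * (2 + 2))
              (cupProduct (rfl : 2 * 1 + 2 * 2 = 2 * 1 + 2 * 2)
                (complexBetti.map (snd S S'') (2 * 1) x) γ))
    (hmark : Huybrechts_K3_marking_exists) (hHT : Huybrechts_K3_hodgeTypes_H2)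
    (hG : Grothendieck1969_supportedClasses_le_hodgeConiveau) :
    Theses.NikulinTwinTransport.RealMultiplicationSqrtTwoAlgebraic :=
  realMultiplicationSqrtTwoAlgebraic_of_rmAnchors hB (corrComp_surfaces_of_cup' hCUP) hA hmark hHT hG

/-- **The route decl from RM-anchors, Buskin and the moving lemma for `2`-cycles on the triple
products `A ⊗ (B ⊗ C)` of smooth projective surfaces** (the support form consumed by
`cupProduct_mem_algebraicClasses_of_moving`, `l = k = 2`; Fulton §11.4, Voisin II Lemma 9.22),
which gives the multiplicativity hypothesis of `realMultiplicationSqrtTwoAlgebraic_of_rmAnchors_of_cup`.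
[cite: Fulton1998, §11.4 Moving Lemma] [cite: VoisinHodgeII2003, §9.2.4 Prop. 9.20 and Lemma 9.22] -/
theorem realMultiplicationSqrtTwoAlgebraic_of_rmAnchors_of_moving
    (hB : Theses.NikulinTwinTransport.HodgeIsometryAlgebraic)
    (hmove : ∀ (A B C : SchemeOver ℂ), IsSmoothProjective 2 A → IsSmoothProjective 2 B →
      IsSmoothProjective 2 C →
      ∀ ⦃Z W : Set (A ⊗ (B ⊗ C)).left⦄, IsClosed Z → (∀ z ∈ Z, ((2 : ℕ) : ℕ∞) ≤ Order.coheight z) →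
        IsClosed W → (∀ w ∈ W, ((2 : ℕ) : ℕ∞) ≤ Order.coheight w) →
          LinearMap.ker (complexBetti.restrictCompl (A ⊗ (B ⊗ C)) Z (2 * 2)).hom ≤
            ⨆ (T : Set (A ⊗ (B ⊗ C)).left) (_ : IsClosed T)
              (_ : ∀ t ∈ T ∩ W, ((2 + 2 : ℕ) : ℕ∞) ≤ Order.coheight t),
              LinearMap.ker (complexBetti.restrictCompl (A ⊗ (B ⊗ C)) T (2 * 2)).hom)
    (hA : ∀ (μ : OrientationFamily), μ.HasPoincareDuality →
      ∀ (S : SchemeOver ℂ) (hS : IsK3Surface S) (p : complexBetti S (2 * 2)),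
      (IsIntegralClass p ∧ ∀ q : complexBetti S (2 * 2), IsIntegralClass q → ∃ n : ℤ, q = n • p) →
      ∀ (e : complexBetti S (2 * 1) →ₗ[ℂ] complexBetti S (2 * 1)),
        (∀ x, IsRationalClass x → IsRationalClass (e x)) →
        (∀ (i j : ℕ) x, IsOfHodgeType 2 S (2 * 1) i j x → IsOfHodgeType 2 S (2 * 1) i j (e x)) →
        (∀ d ∈ algebraicClasses S 1, e d = 0) →
        (∀ x : complexBetti S (2 * 1),
          (∀ d ∈ algebraicClasses S 1, cupProduct (rfl : 2 * 1 + 2 * 1 = 2 * 2) x d = 0) →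
            e (e x) = (2 : ℂ) • x) →
      ∃ (S'' : SchemeOver ℂ) (hS'' : IsK3Surface S'') (p'' : complexBetti S'' (2 * 2)),
        (IsIntegralClass p'' ∧
          ∀ q : complexBetti S'' (2 * 2), IsIntegralClass q → ∃ n : ℤ, q = n • p'') ∧
        ∃ Ψ : complexBetti S'' (2 * 1) ≃ₗ[ℂ] complexBetti S (2 * 1),
          (∀ y, IsRationalClass y → IsRationalClass (Ψ.symm y)) ∧
          (∀ (i j : ℕ) y, IsOfHodgeType 2 S (2 * 1) i j y →
            IsOfHodgeType 2 S'' (2 * 1) i j (Ψ.symm y)) ∧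
          (∀ (u v : complexBetti S (2 * 1)) (b : ℂ),
            cupProduct (rfl : 2 * 1 + 2 * 1 = 2 * 2) u v = ((2 : ℂ) * b) • p →
              cupProduct (rfl : 2 * 1 + 2 * 1 = 2 * 2) (Ψ.symm u) (Ψ.symm v) = b • p'') ∧
          ∃ γ ∈ algebraicClasses (S ⊗ S'') 2, ∀ x : complexBetti S'' (2 * 1),
            Ψ x = complexGysin μ (IsSmoothProjective.tensor_holds hS.1 hS''.1) hS.1 (fst S S'')
              (rfl : 2 * 1 + 2 * 2 + 2 * 2 = 2 * 1 + 2 * (2 + 2))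
              (cupProduct (rfl : 2 * 1 + 2 * 2 = 2 * 1 + 2 * 2)
                (complexBetti.map (snd S S'') (2 * 1) x) γ))
    (hmark : Huybrechts_K3_marking_exists) (hHT : Huybrechts_K3_hodgeTypes_H2)
    (hG : Grothendieck1969_supportedClasses_le_hodgeConiveau) :
    Theses.NikulinTwinTransport.RealMultiplicationSqrtTwoAlgebraic :=
  realMultiplicationSqrtTwoAlgebraic_of_rmAnchors_of_cup hB
    (fun A B C hA hB hC _a ha _b hb =>
      cupProduct_mem_algebraicClasses_of_moving (hmove A B C hA hB hC) ha hb)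
    hA hmark hHT hG

/-- **The deliverable ⟺ RM-anchors at every RM-`√2` surface (self-adjoint form, all Picard
ranks), modulo Buskin, the composition of correspondences and the three named facts.**
(⟸) `realMultiplication_algebraic_at_of_anchors_at`; (⟹) `rmAnchors_of_realMultiplicationSqrtTwoAlgebraic`
(the surface is its own partner, `Ψ = e + ν̃`). So, granted Buskin's theorem and the composition of
algebraic correspondences, the route's deliverable IS the transport crux restricted to the RM-`√2`
surfaces. [cite: Varesco2023, §2, Thm. 2.1 and Rem. 2.2] [cite: Buskin2019, Thm. 1.1]
[cite: VanGeemenSchuett2023, Thm. 3.10 and Rem. 4.9] -/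
theorem realMultiplicationSqrtTwoAlgebraic_iff_rmAnchors_adj
    (hB : Theses.NikulinTwinTransport.HodgeIsometryAlgebraic)
    (hC : ∀ (μ : OrientationFamily), μ.HasPoincareDuality →
      ∀ (A B C : SchemeOver ℂ) (hA : IsSmoothProjective 2 A) (hB : IsSmoothProjective 2 B)
        (hC : IsSmoothProjective 2 C),
        ∀ γ ∈ algebraicClasses (A ⊗ B) 2, ∀ γ₁ ∈ algebraicClasses (B ⊗ C) 2,
          ∃ γ₂ ∈ algebraicClasses (A ⊗ C) 2, ∀ x : complexBetti C (2 * 1),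
            complexGysin μ (IsSmoothProjective.tensor_holds hA hC) hA (fst A C)
                (rfl : 2 * 1 + 2 * 2 + 2 * 2 = 2 * 1 + 2 * (2 + 2))
                (cupProduct (rfl : 2 * 1 + 2 * 2 = 2 * 1 + 2 * 2)
                  (complexBetti.map (snd A C) (2 * 1) x) γ₂) =
              complexGysin μ (IsSmoothProjective.tensor_holds hA hB) hA (fst A B)
                (rfl : 2 * 1 + 2 * 2 + 2 * 2 = 2 * 1 + 2 * (2 + 2))
                (cupProduct (rfl : 2 * 1 + 2 * 2 = 2 * 1 + 2 * 2)
                  (complexBetti.map (snd A B) (2 * 1)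
                    (complexGysin μ (IsSmoothProjective.tensor_holds hB hC) hB (fst B C)
                      (rfl : 2 * 1 + 2 * 2 + 2 * 2 = 2 * 1 + 2 * (2 + 2))
                      (cupProduct (rfl : 2 * 1 + 2 * 2 = 2 * 1 + 2 * 2)
                        (complexBetti.map (snd B C) (2 * 1) x) γ₁)))
                  γ))
    (hmark : Huybrechts_K3_marking_exists) (hHT : Huybrechts_K3_hodgeTypes_H2)
    (hG : Grothendieck1969_supportedClasses_le_hodgeConiveau) :
    Theses.NikulinTwinTransport.RealMultiplicationSqrtTwoAlgebraic ↔
      ∀ (μ : OrientationFamily), μ.HasPoincareDuality →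
        ∀ (S : SchemeOver ℂ) (hS : IsK3Surface S) (p : complexBetti S (2 * 2)),
        (IsIntegralClass p ∧ ∀ q : complexBetti S (2 * 2), IsIntegralClass q → ∃ n : ℤ, q = n • p) →
        ∀ (e : complexBetti S (2 * 1) →ₗ[ℂ] complexBetti S (2 * 1)),
          (∀ x, IsRationalClass x → IsRationalClass (e x)) →
          (∀ (i j : ℕ) x, IsOfHodgeType 2 S (2 * 1) i j x → IsOfHodgeType 2 S (2 * 1) i j (e x)) →
          (∀ x y : complexBetti S (2 * 1),
            cupProduct (rfl : 2 * 1 + 2 * 1 = 2 * 2) (e x) y =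
              cupProduct (rfl : 2 * 1 + 2 * 1 = 2 * 2) x (e y)) →
          (∀ d ∈ algebraicClasses S 1, e d = 0) →
          (∀ x : complexBetti S (2 * 1),
            (∀ d ∈ algebraicClasses S 1, cupProduct (rfl : 2 * 1 + 2 * 1 = 2 * 2) x d = 0) →
              e (e x) = (2 : ℂ) • x) →
        ∃ (S'' : SchemeOver ℂ) (hS'' : IsK3Surface S'') (p'' : complexBetti S'' (2 * 2)),
          (IsIntegralClass p'' ∧
            ∀ q : complexBetti S'' (2 * 2), IsIntegralClass q → ∃ n : ℤ, q = n • p'') ∧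
          ∃ Ψ : complexBetti S'' (2 * 1) ≃ₗ[ℂ] complexBetti S (2 * 1),
            (∀ y, IsRationalClass y → IsRationalClass (Ψ.symm y)) ∧
            (∀ (i j : ℕ) y, IsOfHodgeType 2 S (2 * 1) i j y →
              IsOfHodgeType 2 S'' (2 * 1) i j (Ψ.symm y)) ∧
            (∀ (u v : complexBetti S (2 * 1)) (b : ℂ),
              cupProduct (rfl : 2 * 1 + 2 * 1 = 2 * 2) u v = ((2 : ℂ) * b) • p →
                cupProduct (rfl : 2 * 1 + 2 * 1 = 2 * 2) (Ψ.symm u) (Ψ.symm v) = b • p'') ∧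
            ∃ γ ∈ algebraicClasses (S ⊗ S'') 2, ∀ x : complexBetti S'' (2 * 1),
              Ψ x = complexGysin μ (IsSmoothProjective.tensor_holds hS.1 hS''.1) hS.1 (fst S S'')
                (rfl : 2 * 1 + 2 * 2 + 2 * 2 = 2 * 1 + 2 * (2 + 2))
                (cupProduct (rfl : 2 * 1 + 2 * 2 = 2 * 1 + 2 * 2)
                  (complexBetti.map (snd S S'') (2 * 1) x) γ) :=
  ⟨fun h μ hμ _S hS p hp e he_rat he_type he_adj he_N he_T =>
      rmAnchors_of_realMultiplicationSqrtTwoAlgebraic h hmark hHT hG μ hμ hS p hp e he_rat he_type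
        he_adj he_N he_T,
    fun hA μ hμ _S hS e he_rat he_type he_adj he_N he_T =>
      realMultiplication_algebraic_at_of_anchors_at hB hC hmark hHT hG μ hμ hS
        (fun p hp => hA μ hμ _ hS p hp e he_rat he_type he_adj he_N he_T)
        e he_rat he_type he_adj he_N he_T⟩

end Summit.HodgeConjecture.HodgeConjecture.Theorems.NikulinTwinTransport

end
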